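/-
Copyright: the b2b-balaban T⁴-continuum CRUX team, row NE7b leaf lineage `t4-ne7b-formalise-leaf-06` (gen 156). Project licence.
-/
import Summits.QuantumFields.BalabanUV.T4Continuum.Spine.NE7b.QuadraticFibreMinimiser
import Mathlib.Analysis.Normed.Operator.Bilinear
import Mathlib.Analysis.Calculus.FDeriv.Comp
import Mathlib.Analysis.Calculus.FDeriv.Linear
import Mathlib.Analysis.Calculus.FDeriv.Congr
import Mathlib.Analysis.Calculus.FDeriv.Const
import Mathlib.Tactic.Positivity
import Mathlib.Tactic.Linarith
import Mathlib.Tactic.FieldSimp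

/-!
# THE TRANSPORTED HESSIAN IS BELOW THE ENERGY OF ANY TEST SECTION: along a constrained-critical branch the branch derivative `σ′` is
# `V″`-orthogonal to `ker D`, hence `V″[σ′k, σ′k] ≤ V″[Sk, Sk]` for EVERY section `S` of the blocking (`V″ ≥ 0` on `ker D`); with
# `V″ ≥ 0` and a test section of energy `≤ C‖k‖²` the transported Hessian has operator norm `≤ C` — the SIZE letter the unit box
# needs in place of `‖V″‖·‖σ′‖²`; and the branch derivative's NORM is `≤ ‖S‖ + √(C∕m)` — the chart letter through the same
# energy, with the condition number under a square root (row NE7b, node U5c; [folklore] — Pythagoras for a form, polarisation)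

Cell `pub-balaban`, sub-cell `t4`, spine estimate NE7b (`T4WeightBudget.RelWeightBound`; the cell's OWN estimate — NOT PRINTED in
[Bałaban 1983–89], NOT PROVED).  Crux-route work under `Spine/NE7b/` by a row leaf (`t4-ne7b-formalise-leaf-06` gen 156) in the
hard-step cell under FREEZE (0)'s crux-prover clause; NOTHING of Bałaban's is named as a Lean object, valued or asserted; no
`T4Continuum/Support` leaf typed; no `def`; zero `sorry`.  Imports: leaf-03's BUILT `…QuadraticFibreMinimiser` (QFM: `le_of_orthogonal_ker`
— the `Q`-orthogonal fibre point minimises the energy on its fibre — BY NAME) + Mathlib.  Consumers: this lineage's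
`…HardStepUnitBox` (HSUB: its §3b located that the crude size letter `B⁺ = B‖σ′‖²` of `…HardStepActionHessian` (HSAH) cannot close
on the free field; its §1 arithmetic accepts any size letter in place of `K₁²` in `Θ`), `…HardStepInductiveStep` (HSIS (c): the next
Hessian IS `V″(σw)[σ′w·, σ′w·]`), leaf-04's `…HardStepBranchDeriv` (HSBD: `σ′ = A⁻¹ ∘ inl` — `D ∘ σ′ = 1` and `V″(δ₀)(σ′k)|_{ker D} = 0`
are the two letters §1 consumes), leaf-01's `…SchurPairFromLetters` (SPFL: the matrix twin, `form_P_le_of_letters`).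

WHY.  HSAH bounds the transported Hessian by `‖V″‖·‖σ′‖²`; in coercivity units this makes the Hessian-size ratio grow by
`Θ = K₁²d²∕γ` per step, and HSUB §3b shows `Θ ≤ 1` is impossible on Laplacian data (`γ = L⁻²`).  The true mechanism (the pricing
desk's F674 ∕ print's localised letters, «minimiser smoothing») is elementary at the level of forms: the critical branch is
`V″`-ORTHOGONAL to the fibre (`V″(σw)[σ′(w)k, κ] = 0` for `κ ∈ ker D` — differentiate the branch's defining criticality along
`ker D`; HSBD's `σ′ = A⁻¹∘inl` says exactly this at the centre), so by Pythagoras for the form, `V″[σ′k,σ′k] = V″[Sk,Sk] − V″[n,n]`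
with `n = Sk − σ′k ∈ ker D`, i.e. the branch's energy is the LEAST among all sections when `V″ ≥ 0` on `ker D`.  Any explicit test
section `S` with small energy (a smooth interpolation: `C ≈ B∕L²·‖S‖²` for Laplacians) therefore bounds the transported Hessian's
quadratic form, and — by polarisation in the inner-product space `F` — its operator norm.  This is the size letter that can close.

WHAT IS PROVED ([folklore]; `E` a real inner-product space (QFM's context), `F` real normed ∕ inner-product, `Q : E →L E →L ℝ`,
`D : E →L F`, sections `T, S : F →L E`):
* §1 THE BRANCH HAS THE LEAST ENERGY (QFM BY NAME): **`bilinearComp_quad_le`** (`DT = DS = 1`, `Q(Tk)|_{ker D} = 0`, `Q` symmetric and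
  `≥ 0` on `ker D`, a test-section letter `Q(Sk)(Sk) ≤ C‖k‖²` ⟹ `(Q.bilinearComp T T) k k ≤ C‖k‖²`), `bilinearComp_quad_nonneg`;
  **`orthogonal_of_criticalBranch`** — THE ORTHOGONALITY LETTER ALONG THE WHOLE CHART: `σ` differentiable on an open `U`,
  `V′(σw)|_{ker D} = 0` on `U` (HSCR's branch), `HasFDerivAt (fderiv V) (V″(σw)) (σw)` ⟹ `V″(σw)[σ′(w)h, κ] = 0` for `κ ∈ ker D`
  (chain rule on the identically-zero `w ↦ V′(σw)κ`); **`norm_branch_apply_le_of_testSection`** ∕ **`opNorm_branch_le_of_testSection`** —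
  THE CHART LETTER THROUGH A TEST SECTION: `Q ≥ 0`, `m`-coercive on `ker D` ⟹ `‖Tk‖ ≤ ‖Sk‖ + √(Q(Sk)(Sk)∕m)`, `‖T‖ ≤ ‖S‖ + √(C∕m)`
  (QFM `form_split` BY NAME: the energy defect sits on `Sk − Tk ∈ ker D`) — the square-root form of QFM ∕ AHE's `(1 + ‖Q‖∕m)‖M‖`.
* §2 POLARISATION (`F` an inner-product space): `abs_apply_le_of_abs_quad_le` (`P : F →L F →L ℝ` symmetric, `|P k k| ≤ M‖k‖²` ⟹
  `|P u v| ≤ M‖u‖‖v‖`), **`opNorm_le_of_abs_quad_le`** (`⟹ ‖P‖ ≤ M`).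
* §3 THE END **`opNorm_transportedHessian_le_of_testSection`**: `Q` symmetric and `≥ 0` on `E`, `T` a section `Q`-orthogonal to `ker D`,
  `S` a section with `Q(Sk)(Sk) ≤ C‖k‖²` (`C ≥ 0`), `F` inner-product ⟹ `‖Q.bilinearComp T T‖ ≤ C` — HSIS (c)'s ∕ HSUB's Hessian-size
  letter through the ENERGY of a test section instead of `‖Q‖·‖T‖²`; **`opNorm_transportedHessian_le_on_chart`** — the same along an open
  chart from HSCR ∕ HSIS-shaped letters (`D∘σ′ = 1`, constrained criticality, `HasFDerivAt (fderiv V) (V″(σw))`), the orthogonality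
  supplied by §1.
* §4 toy: the degenerate case `S = T`.

NOT HERE (honest): the test sections and their energies for print's
blockings ((A3) ∕ (A1c); leaf-01's TSPB ∕ FFTI letters value the block-constant section, whose Laplacian energy is `O(L^{d−1})` per unit
jump — the smooth interpolant is the one that closes), indefinite `V″` (only `V″ ≥ 0` on `E` is treated in §3; §1 needs it on `ker D`
only), anything of Bałaban's.  BY-NAME EFFECT ON THE WALL: NONE.  NE7b NOT PRINTED ∕ NOT PROVED; spine PROVED 0∕9; rung (B)+1 on a
FINITE torus — NOT infinite volume, NOT the mass gap, NOT Clay.  HONEST DEPENDENCY: continuum YM on T⁴ ⇐ BetaPertH ∧ nine spine estimates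
(0∕9 proved); BetaPertH ⇐ (D1) ∧ (D4) ∧ CAP+tail; G-an2-4 gates asym, D1 and NE2∕3∕4.
-/

set_option autoImplicit false

namespace Summit.QuantumFields.BalabanUV.T4Continuum.NE7b.TransportedHessianEnergyCeiling

/-! ## §1. The branch has the least energy among sections (QFM `le_of_orthogonal_ker` BY NAME) -/

section LeastEnergy

variable {E F : Type*} [NormedAddCommGroup E] [InnerProductSpace ℝ E] [NormedAddCommGroup F] [NormedSpace ℝ F]

/-- **A TEST SECTION's ENERGY LETTER BOUNDS THE TRANSPORTED FORM**: `T`, `S` sections of `D`, `Q(Tk)` vanishing on `ker D`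
(the critical branch's letter), `Q` symmetric and `≥ 0` on `ker D`, and ONE section `S` with `Q(Sk)(Sk) ≤ C‖k‖²` ⟹
`(Q.bilinearComp T T) k k ≤ C‖k‖²` — leaf-03's `QuadraticFibreMinimiser.le_of_orthogonal_ker` (the `Q`-orthogonal fibre point
minimises the energy on its fibre) BY NAME at `x := Sk`, `h := Tk`. [folklore] -/
theorem bilinearComp_quad_le (Q : E →L[ℝ] E →L[ℝ] ℝ) (D : E →L[ℝ] F) (T S : F →L[ℝ] E) (hT : ∀ k, D (T k) = k)
    (hS : ∀ k, D (S k) = k) (horth : ∀ k κ, D κ = 0 → Q (T k) κ = 0) (hsymm : ∀ u v, Q u v = Q v u)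
    (hpos : ∀ κ, D κ = 0 → 0 ≤ Q κ κ) {C : ℝ} (hC : ∀ k, Q (S k) (S k) ≤ C * ‖k‖ ^ 2) (k : F) :
    (Q.bilinearComp T T) k k ≤ C * ‖k‖ ^ 2 := by
  rw [ContinuousLinearMap.bilinearComp_apply]
  exact (QuadraticFibreMinimiser.le_of_orthogonal_ker hsymm hpos ((hS k).trans (hT k).symm) (horth k)).trans (hC k)

/-- The transported form of a nonnegative form is nonnegative. [folklore] -/
theorem bilinearComp_quad_nonneg (Q : E →L[ℝ] E →L[ℝ] ℝ) (T : F →L[ℝ] E) (hQ0 : ∀ v, 0 ≤ Q v v) (k : F) :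
    0 ≤ (Q.bilinearComp T T) k k := by
  rw [ContinuousLinearMap.bilinearComp_apply]; exact hQ0 _

/-- **THE ORTHOGONALITY LETTER ALONG THE WHOLE CHART.**  If `σ` is differentiable on an open set `U`, the branch is constrained-
critical there (`V′(σ w)` vanishes on `ker D` for every `w ∈ U` — HSCR's `exists_criticalBranch_chart_ker` output) and `V′` has
derivative `V″(σ w)` at `σ w`, then `V″(σ w)[σ′(w) h, κ] = 0` for all `h` and all `κ ∈ ker D`: differentiate the identically-zero
scalar function `w ↦ V′(σ w) κ` (chain rule through the evaluation functional). [folklore] -/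
theorem orthogonal_of_criticalBranch {V : E → ℝ} {V'' : E → E →L[ℝ] E →L[ℝ] ℝ} {σ : F → E} (D : E →L[ℝ] F)
    {U : Set F} (hU : IsOpen U) (hσ : ∀ w ∈ U, DifferentiableAt ℝ σ w)
    (hcrit : ∀ w ∈ U, ∀ κ, D κ = 0 → fderiv ℝ V (σ w) κ = 0)
    (hV : ∀ w ∈ U, HasFDerivAt (fderiv ℝ V) (V'' (σ w)) (σ w)) {w : F} (hw : w ∈ U) (h : F) {κ : E} (hκ : D κ = 0) :
    V'' (σ w) (fderiv ℝ σ w h) κ = 0 := by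
  have hg0 : (fun w' => fderiv ℝ V (σ w') κ) =ᶠ[nhds w] fun _ => (0 : ℝ) := by
    filter_upwards [hU.mem_nhds hw] with w' hw'
    exact hcrit w' hw' κ hκ
  have hfd0 : fderiv ℝ (fun w' => fderiv ℝ V (σ w') κ) w = 0 := by
    rw [hg0.fderiv_eq]; exact (hasFDerivAt_const (0 : ℝ) w).fderiv
  have hinner : HasFDerivAt (fun w' => fderiv ℝ V (σ w')) ((V'' (σ w)).comp (fderiv ℝ σ w)) w :=
    (hV w hw).comp w (hσ w hw).hasFDerivAt
  have hchain : HasFDerivAt (fun w' => fderiv ℝ V (σ w') κ)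
      ((ContinuousLinearMap.apply ℝ ℝ κ).comp ((V'' (σ w)).comp (fderiv ℝ σ w))) w :=
    ((ContinuousLinearMap.apply ℝ ℝ κ).hasFDerivAt).comp w hinner
  have e := hchain.fderiv
  rw [hfd0] at e
  have e2 := congrArg (fun L : F →L[ℝ] ℝ => L h) e
  simpa using e2.symm

/-- **THE BRANCH DERIVATIVE's NORM THROUGH A TEST SECTION's ENERGY (the chart letter's square-root form).**  `T`, `S` sections,
`Q(Tk)|_{ker D} = 0`, `Q` symmetric, `Q ≥ 0` on `E`, `Q` `m`-coercive on `ker D` (`m > 0`) ⟹ `‖Tk‖ ≤ ‖Sk‖ + √(Q(Sk)(Sk) ∕ m)`: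
Pythagoras (QFM `form_split` at `x := Sk`) puts the whole energy defect on `n = Sk − Tk ∈ ker D`, where coercivity converts it into
norm.  Compare QFM's crude `‖Tk‖ ≤ (1 + ‖Q‖∕m)‖Mk‖`: the condition number enters under a square root and through the TEST section's
energy, not through `‖Q‖`. [folklore] -/
theorem norm_branch_apply_le_of_testSection (Q : E →L[ℝ] E →L[ℝ] ℝ) (D : E →L[ℝ] F) (T S : F →L[ℝ] E)
    (hT : ∀ k, D (T k) = k) (hS : ∀ k, D (S k) = k) (horth : ∀ k κ, D κ = 0 → Q (T k) κ = 0)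
    (hsymm : ∀ u v, Q u v = Q v u) (hQ0 : ∀ v, 0 ≤ Q v v) {m : ℝ} (hm : 0 < m)
    (hco : ∀ κ, D κ = 0 → m * ‖κ‖ ^ 2 ≤ Q κ κ) (k : F) :
    ‖T k‖ ≤ ‖S k‖ + Real.sqrt (Q (S k) (S k) / m) := by
  -- Pythagoras along the fibre of `k`: `Q(Sk)(Sk) = Q(Tk)(Tk) + Q(n)(n)`, `n = Sk − Tk ∈ ker D`
  have hsplit := QuadraticFibreMinimiser.form_split (Q := Q) (D := D) (H := T) hsymm hT horth (S k)
  rw [hS] at hsplit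
  have hn : D (S k - T k) = 0 := by rw [map_sub, hS, hT, sub_self]
  have h1 : m * ‖S k - T k‖ ^ 2 ≤ Q (S k) (S k) := by
    have := hco _ hn
    linarith [hQ0 (T k)]
  have h2 : ‖S k - T k‖ ^ 2 ≤ Q (S k) (S k) / m := by
    rw [le_div_iff₀ hm]; linarith
  have h3 : ‖S k - T k‖ ≤ Real.sqrt (Q (S k) (S k) / m) := by
    rw [← Real.sqrt_sq (norm_nonneg (S k - T k))]
    exact Real.sqrt_le_sqrt h2
  calc ‖T k‖ = ‖S k - (S k - T k)‖ := by rw [sub_sub_cancel]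
    _ ≤ ‖S k‖ + ‖S k - T k‖ := norm_sub_le _ _
    _ ≤ ‖S k‖ + Real.sqrt (Q (S k) (S k) / m) := by linarith

/-- **THE CHART LETTER THROUGH A TEST SECTION**: with the energy letter `Q(Sk)(Sk) ≤ C‖k‖²` (`C ≥ 0`):
`‖T‖ ≤ ‖S‖ + √(C∕m)` — in place of QFM ∕ AHE's `(1 + ‖Q‖∕m)‖M‖` wherever a good test section is at hand. [folklore] -/
theorem opNorm_branch_le_of_testSection (Q : E →L[ℝ] E →L[ℝ] ℝ) (D : E →L[ℝ] F) (T S : F →L[ℝ] E)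
    (hT : ∀ k, D (T k) = k) (hS : ∀ k, D (S k) = k) (horth : ∀ k κ, D κ = 0 → Q (T k) κ = 0)
    (hsymm : ∀ u v, Q u v = Q v u) (hQ0 : ∀ v, 0 ≤ Q v v) {m : ℝ} (hm : 0 < m)
    (hco : ∀ κ, D κ = 0 → m * ‖κ‖ ^ 2 ≤ Q κ κ) {C : ℝ} (hC0 : 0 ≤ C) (hC : ∀ k, Q (S k) (S k) ≤ C * ‖k‖ ^ 2) :
    ‖T‖ ≤ ‖S‖ + Real.sqrt (C / m) := by
  refine ContinuousLinearMap.opNorm_le_bound _ (by positivity) fun k => ?_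
  have h1 := norm_branch_apply_le_of_testSection Q D T S hT hS horth hsymm hQ0 hm hco k
  have h2 : Real.sqrt (Q (S k) (S k) / m) ≤ Real.sqrt (C / m) * ‖k‖ := by
    rw [← Real.sqrt_sq (norm_nonneg k), ← Real.sqrt_mul (div_nonneg hC0 hm.le)]
    exact Real.sqrt_le_sqrt (by rw [div_mul_eq_mul_div]; exact div_le_div_of_nonneg_right (hC k) hm.le)
  calc ‖T k‖ ≤ ‖S k‖ + Real.sqrt (Q (S k) (S k) / m) := h1
    _ ≤ ‖S‖ * ‖k‖ + Real.sqrt (C / m) * ‖k‖ := add_le_add (S.le_opNorm k) h2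
    _ = (‖S‖ + Real.sqrt (C / m)) * ‖k‖ := by ring

end LeastEnergy

/-! ## §2. Polarisation: a symmetric form is bounded by its quadratic form -/

section Polarisation

variable {F : Type*} [NormedAddCommGroup F] [InnerProductSpace ℝ F]

/-- **POLARISATION BOUND**: `P` symmetric with `|P k k| ≤ M‖k‖²` on an inner-product space ⟹ `|P u v| ≤ M‖u‖‖v‖`
(`4 P u v = P(u+v)(u+v) − P(u−v)(u−v)`, the parallelogram law, and the rescaling `u ↦ a•u`, `v ↦ a⁻¹•v`). [folklore] -/
theorem abs_apply_le_of_abs_quad_le (P : F →L[ℝ] F →L[ℝ] ℝ) (hsymm : ∀ u v, P u v = P v u) {M : ℝ}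
    (hM : ∀ k, |P k k| ≤ M * ‖k‖ ^ 2) (u v : F) : |P u v| ≤ M * (‖u‖ * ‖v‖) := by
  -- the half-sum bound from polarisation + parallelogram
  have half : ∀ x y : F, |P x y| ≤ M * (‖x‖ ^ 2 + ‖y‖ ^ 2) / 2 := by
    intro x y
    have e : P x y = (P (x + y) (x + y) - P (x - y) (x - y)) / 4 := by
      simp only [map_add, map_sub, add_apply, sub_apply, hsymm y x]
      ring
    have hp := hM (x + y)
    have hm := hM (x - y)
    have par : ‖x + y‖ ^ 2 + ‖x - y‖ ^ 2 = 2 * (‖x‖ ^ 2 + ‖y‖ ^ 2) := by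
      have := parallelogram_law_with_norm ℝ x y
      nlinarith [this]
    rw [e, abs_div, abs_of_pos (by norm_num : (0:ℝ) < 4)]
    have h4 : |P (x + y) (x + y) - P (x - y) (x - y)| ≤ M * ‖x + y‖ ^ 2 + M * ‖x - y‖ ^ 2 :=
      (abs_sub _ _).trans (add_le_add hp hm)
    have : M * ‖x + y‖ ^ 2 + M * ‖x - y‖ ^ 2 = 2 * (M * (‖x‖ ^ 2 + ‖y‖ ^ 2)) := by rw [← mul_add, par]; ring
    rw [this] at h4
    linarith
  -- rescale
  by_cases hu : u = 0
  · subst hu; simp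
  by_cases hv : v = 0
  · subst hv; simp
  have hu' : 0 < ‖u‖ := norm_pos_iff.mpr hu
  have hv' : 0 < ‖v‖ := norm_pos_iff.mpr hv
  set a : ℝ := Real.sqrt (‖v‖ / ‖u‖) with ha
  have ha0 : 0 < a := Real.sqrt_pos.mpr (div_pos hv' hu')
  have ha2 : a ^ 2 = ‖v‖ / ‖u‖ := Real.sq_sqrt (div_pos hv' hu').le
  have h := half (a • u) (a⁻¹ • v)
  have e1 : P (a • u) (a⁻¹ • v) = P u v := by
    simp only [map_smul, smul_apply, smul_eq_mul]
    field_simp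
  have e2 : ‖a • u‖ ^ 2 + ‖a⁻¹ • v‖ ^ 2 = 2 * (‖u‖ * ‖v‖) := by
    rw [norm_smul, norm_smul, Real.norm_eq_abs, Real.norm_eq_abs, abs_of_pos ha0, abs_of_pos (inv_pos.mpr ha0), mul_pow,
      mul_pow, inv_pow, ha2]
    field_simp
    ring
  rw [e1, e2] at h
  linarith

/-- **THE OPERATOR NORM OF A SYMMETRIC FORM IS BOUNDED BY ITS QUADRATIC FORM** (inner-product space): `|P k k| ≤ M‖k‖²`, `0 ≤ M` ⟹
`‖P‖ ≤ M`. [folklore] -/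
theorem opNorm_le_of_abs_quad_le (P : F →L[ℝ] F →L[ℝ] ℝ) (hsymm : ∀ u v, P u v = P v u) {M : ℝ} (hM0 : 0 ≤ M)
    (hM : ∀ k, |P k k| ≤ M * ‖k‖ ^ 2) : ‖P‖ ≤ M := by
  refine ContinuousLinearMap.opNorm_le_bound _ hM0 fun u => ?_
  refine ContinuousLinearMap.opNorm_le_bound _ (by positivity) fun v => ?_
  rw [Real.norm_eq_abs]
  calc |P u v| ≤ M * (‖u‖ * ‖v‖) := abs_apply_le_of_abs_quad_le P hsymm hM u v
    _ = M * ‖u‖ * ‖v‖ := by ring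

end Polarisation

/-! ## §3. The END: the transported Hessian's size through a test section's energy -/

section TheEnd

variable {E F : Type*} [NormedAddCommGroup E] [InnerProductSpace ℝ E] [NormedAddCommGroup F] [InnerProductSpace ℝ F]

/-- **THE SIZE LETTER THROUGH A TEST SECTION.**  `Q` symmetric and nonnegative on `E` (the Hessian at a point of a convex window),
`T` a section of `D` that is `Q`-orthogonal to `ker D` (the critical branch's derivative), `S` ANY section with the energy letter
`Q(Sk)(Sk) ≤ C‖k‖²` (`C ≥ 0`), `F` an inner-product space ⟹ the transported Hessian `Q[T·, T·]` has `‖Q.bilinearComp T T‖ ≤ C` —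
to be used in place of HSAH's `‖Q‖·‖T‖²` wherever a good test section is at hand. [folklore] -/
theorem opNorm_transportedHessian_le_of_testSection (Q : E →L[ℝ] E →L[ℝ] ℝ) (D : E →L[ℝ] F) (T S : F →L[ℝ] E)
    (hT : ∀ k, D (T k) = k) (hS : ∀ k, D (S k) = k) (horth : ∀ k κ, D κ = 0 → Q (T k) κ = 0) (hsymm : ∀ u v, Q u v = Q v u)
    (hQ0 : ∀ v, 0 ≤ Q v v) {C : ℝ} (hC0 : 0 ≤ C) (hC : ∀ k, Q (S k) (S k) ≤ C * ‖k‖ ^ 2) :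
    ‖Q.bilinearComp T T‖ ≤ C := by
  have hsymm' : ∀ u v, (Q.bilinearComp T T) u v = (Q.bilinearComp T T) v u := by
    intro u v; rw [ContinuousLinearMap.bilinearComp_apply, ContinuousLinearMap.bilinearComp_apply, hsymm]
  refine opNorm_le_of_abs_quad_le _ hsymm' hC0 fun k => ?_
  rw [abs_of_nonneg (bilinearComp_quad_nonneg Q T hQ0 k)]
  exact bilinearComp_quad_le Q D T S hT hS horth hsymm (fun κ _ => hQ0 κ) hC k

/-- **THE SIZE LETTER ALONG THE CHART.**  On an open chart `U` where the branch `σ` is differentiable with `D ∘ σ′(w) = 1`,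
constrained-critical (`V′(σw)|_{ker D} = 0`) and `V′` has derivative `V″(σ w)` at `σ w`: if `V″(σ w)` is symmetric and `≥ 0` and a test
section `S` has `V″(σw)(Sk)(Sk) ≤ C‖k‖²`, then the next Hessian of HSIS (c), `V″(σ w)[σ′(w)·, σ′(w)·]`, has operator norm `≤ C` —
`orthogonal_of_criticalBranch` feeds §3's END. [folklore] -/
theorem opNorm_transportedHessian_le_on_chart {V : E → ℝ} {V'' : E → E →L[ℝ] E →L[ℝ] ℝ} {σ : F → E}
    (D : E →L[ℝ] F) {U : Set F} (hU : IsOpen U) (hσ : ∀ w ∈ U, DifferentiableAt ℝ σ w)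
    (hsec : ∀ w ∈ U, ∀ k, D (fderiv ℝ σ w k) = k) (hcrit : ∀ w ∈ U, ∀ κ, D κ = 0 → fderiv ℝ V (σ w) κ = 0)
    (hV : ∀ w ∈ U, HasFDerivAt (fderiv ℝ V) (V'' (σ w)) (σ w)) {w : F} (hw : w ∈ U)
    (hsymm : ∀ u v, V'' (σ w) u v = V'' (σ w) v u) (hQ0 : ∀ v, 0 ≤ V'' (σ w) v v)
    (S : F →L[ℝ] E) (hS : ∀ k, D (S k) = k) {C : ℝ} (hC0 : 0 ≤ C) (hC : ∀ k, V'' (σ w) (S k) (S k) ≤ C * ‖k‖ ^ 2) :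
    ‖(V'' (σ w)).bilinearComp (fderiv ℝ σ w) (fderiv ℝ σ w)‖ ≤ C :=
  opNorm_transportedHessian_le_of_testSection (V'' (σ w)) D (fderiv ℝ σ w) S (hsec w hw) hS
    (fun h _ hκ => orthogonal_of_criticalBranch D hU hσ hcrit hV hw h hκ) hsymm hQ0 hC0 hC

end TheEnd

/-! ## §4. Toy -/

/-- Toy (degenerate case `S = T`): if the branch itself carries the energy letter `Q(Tk)(Tk) ≤ C‖k‖²`, the END returns `‖Q[T·,T·]‖ ≤ C`
— the orthogonality letter is then used only through Pythagoras with `n = 0`. -/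
example {E F : Type*} [NormedAddCommGroup E] [InnerProductSpace ℝ E] [NormedAddCommGroup F] [InnerProductSpace ℝ F]
    (Q : E →L[ℝ] E →L[ℝ] ℝ) (D : E →L[ℝ] F) (T : F →L[ℝ] E) (hT : ∀ k, D (T k) = k)
    (horth : ∀ k κ, D κ = 0 → Q (T k) κ = 0) (hsymm : ∀ u v, Q u v = Q v u) (hQ0 : ∀ v, 0 ≤ Q v v) {C : ℝ} (hC0 : 0 ≤ C)
    (hC : ∀ k, Q (T k) (T k) ≤ C * ‖k‖ ^ 2) : ‖Q.bilinearComp T T‖ ≤ C :=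
  opNorm_transportedHessian_le_of_testSection Q D T T hT hT horth hsymm hQ0 hC0 hC

end Summit.QuantumFields.BalabanUV.T4Continuum.NE7b.TransportedHessianEnergyCeiling
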